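import Mathlib
import HarnessLib

/-!
# ARM B / B1 — the CLOSING INEQUALITY of the Pineau–Vicol §7 near-one chain, typed (ns-wall-extremal
  PREREG-WALL-1 A1 §B1 «cert hand types the final inequality as a CONDITIONAL Lean lemma»; exp-lead
  «B1-type» for the RESULTS §B1 honesty line)

What is typed here is ONLY the last, elementary step of the chain in `ARM-B/B1-PARAM.md` (eng-1, PV 2026
§7, α = 0, route (i)): if the enstrophy `E(s) = ‖Ω(s)‖²_{L²}` of an `S`-periodic profile obeys the closed
balance `½E′ + ¼E ≤ ⅛E + C₁C″√S·E` (step (4)(i): the stretching term split at `R̄`, the local part bounded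
by `C₁‖Ω‖²_{L²(B_R̄)} ≤ C₁C″√S·E` from step (3)), then `E ≡ 0` as soon as `S < S_i := (8C₁C″)⁻²` — a
periodic non-negative function with `E′ ≤ −κE`, `κ > 0`, vanishes.  The analytic CONTENT of the chain
(steps (1)–(3): fluctuation bound, weighted identity with the Harnack weight, local enstrophy) is NOT
typed: it enters as the hypothesis `hbal`; the constants `C₁, C″` are the NAMED class inputs of B1-PARAM.
`periodic_nonneg_eq_zero_of_deriv_le` is the reusable real-variable lemma (same mechanism as the kind-M
Lyapunov rows).  Nothing here bears on NS regularity; the near-one window itself is the tree rung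
`FlatWindow.removingDss_explicitWindow` / kind-W rows of `…DssWindowCert`.
-/

noncomputable section

set_option linter.dupNamespace false

namespace Summit.NavierStokesRegularity.NavierStokesRegularity.Cruxes.ScarEnvelopeTypeI.DssWindowCert

/-- **A periodic non-negative `C¹` function with `E′ ≤ −κE` (`κ > 0`) vanishes identically.**
(`E` is antitone, and a periodic antitone function is constant; then `κE ≤ −E′ = 0`.) -/
theorem periodic_nonneg_eq_zero_of_deriv_le {E E' : ℝ → ℝ} {S κ : ℝ} (hS : 0 < S) (hκ : 0 < κ)
    (hper : Function.Periodic E S) (hE : ∀ s, HasDerivAt E (E' s) s) (hnn : ∀ s, 0 ≤ E s)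
    (hineq : ∀ s, E' s ≤ -κ * E s) : ∀ s, E s = 0 := by
  have hdiff : Differentiable ℝ E := fun s => (hE s).differentiableAt
  have hanti : Antitone E := by
    refine antitone_of_deriv_nonpos hdiff fun s => ?_
    rw [(hE s).deriv]
    have := hineq s
    nlinarith [hnn s]
  have hconst : ∀ s t, E s = E t := by
    suffices key : ∀ s t, s ≤ t → E s = E t by
      intro s t
      rcases le_total s t with hst | hts
      · exact key s t hst
      · exact (key t s hts).symm
    intro s t hst
    obtain ⟨k, hk⟩ := Archimedean.arch (t - s) hS
    have h1 : E t ≤ E s := hanti hst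
    have h2 : E (s + k • S) = E s := (hper.nsmul k) s
    have h3 : E (s + k • S) ≤ E t := hanti (by linarith)
    linarith
  intro s
  have hzero : E' s = 0 := by
    have hc : HasDerivAt E 0 s := by
      have hfun : E = fun _ => E 0 := funext fun t => hconst t 0
      rw [hfun]; exact hasDerivAt_const s (E 0)
    exact (hE s).unique hc
  have h1 := hineq s
  rw [hzero] at h1
  nlinarith [hnn s]

/-- Route (i) window of B1-PARAM: `S_i(C₁, C″) := (8 C₁ C″)⁻²`. -/
def windowSi (C₁ C'' : ℝ) : ℝ := ((8 * C₁ * C'')⁻¹) ^ 2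

/-- **B1 closing step (PV 2026 §7 (7.12) + Prop 3.1, route (i) of B1-PARAM), CONDITIONAL on the
balance.**  If the `S`-periodic enstrophy `E ≥ 0` of a profile satisfies
`½E′ + ¼E ≤ ⅛E + C₁C″√S·E` for all `s` (the chain's steps (1)–(3) packaged as a hypothesis, with the
named class inputs `C₁ > 0`, `C″ > 0`), and the period is inside the window `S < S_i = (8C₁C″)⁻²`, then
`E ≡ 0` (hence `Ω ≡ 0` and the profile is trivial — that last implication is NOT typed here). -/
theorem b1_closing {E E' : ℝ → ℝ} {S C₁ C'' : ℝ} (hS : 0 < S) (hC₁ : 0 < C₁) (hC'' : 0 < C'')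
    (hwin : S < windowSi C₁ C'') (hper : Function.Periodic E S) (hE : ∀ s, HasDerivAt E (E' s) s)
    (hnn : ∀ s, 0 ≤ E s)
    (hbal : ∀ s, (1 / 2) * E' s + (1 / 4) * E s ≤ (1 / 8) * E s + C₁ * C'' * Real.sqrt S * E s) :
    ∀ s, E s = 0 := by
  -- the window gives `C₁ C″ √S < 1/8`
  have hprod : 0 < 8 * C₁ * C'' := by positivity
  have hsqrt : Real.sqrt S < (8 * C₁ * C'')⁻¹ := by
    rw [windowSi] at hwin
    have h := Real.sqrt_lt_sqrt hS.le hwin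
    rwa [Real.sqrt_sq (by positivity)] at h
  have hgap : C₁ * C'' * Real.sqrt S < 1 / 8 := by
    have : C₁ * C'' * Real.sqrt S < C₁ * C'' * (8 * C₁ * C'')⁻¹ :=
      mul_lt_mul_of_pos_left hsqrt (by positivity)
    rw [show C₁ * C'' * (8 * C₁ * C'')⁻¹ = 1 / 8 by field_simp] at this
    exact this
  set κ : ℝ := 2 * (1 / 8 - C₁ * C'' * Real.sqrt S) with hκdef
  have hκ : 0 < κ := by rw [hκdef]; linarith
  refine periodic_nonneg_eq_zero_of_deriv_le hS hκ hper hE hnn fun s => ?_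
  have := hbal s
  rw [hκdef]
  nlinarith [hnn s]

/-! ## Appended 2026-08-28 (ns-wall-eng-7's reading of B1-PARAM §2 (4), cell INBOX 17:40:08Z)

`b1_closing` above types the balance EXACTLY as B1-PARAM (4)(i) displays it (linear in `E`).  eng-7 observes
that the chain's step (3) is an ABSOLUTE bound `‖Ω(s)‖_{L²(B_R̄)} ≤ C″√S`, so the honest route-(i) balance is
`½E′ + ⅛E ≤ C₁C″√S·√E` — which only bounds the mean enstrophy (`b1_routeI_mean_bound` is NOT claimed
here) and does NOT force `E ≡ 0` without a class floor; PV's own route (ii) has the LINEAR form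
`½E′ + ¼E + D ≤ ⅛E + c√S·(E + D)` with `D = ‖∇Ω‖² ≥ 0`, `c = θ₀K^{3/2}C_RR·C″`, and closes for
`S < S_ii = (8c)⁻²`.  `b1_closing_routeII` types that step (same mechanism); the window of record per row
is then `windowSi` applied to `c` (= B1-PARAM's `S_ii`).  Conditional as before: the balance is the hypothesis. -/

/-- **B1 closing step, PV route (ii) form (B1-PARAM §2 (4)(ii)), CONDITIONAL on the balance.**  If the
`S`-periodic enstrophy `E ≥ 0` and dissipation `D ≥ 0` of a profile satisfy
`½E′ + ¼E + D ≤ ⅛E + c√S·(E + D)` for all `s` (with the route-(ii) constant `c > 0`, e.g.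
`c = θ₀K^{3/2}C_RR·C″`), and `S < (8c)⁻² = windowSi 1 c`, then `E ≡ 0`. -/
theorem b1_closing_routeII {E E' D : ℝ → ℝ} {S c : ℝ} (hS : 0 < S) (hc : 0 < c)
    (hwin : S < windowSi 1 c) (hper : Function.Periodic E S) (hE : ∀ s, HasDerivAt E (E' s) s)
    (hnn : ∀ s, 0 ≤ E s) (hD : ∀ s, 0 ≤ D s)
    (hbal : ∀ s, (1 / 2) * E' s + (1 / 4) * E s + D s ≤ (1 / 8) * E s + c * Real.sqrt S * (E s + D s)) :
    ∀ s, E s = 0 := by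
  have hprod : 0 < 8 * (1 : ℝ) * c := by positivity
  have hsqrt : Real.sqrt S < (8 * (1 : ℝ) * c)⁻¹ := by
    rw [windowSi] at hwin
    have h := Real.sqrt_lt_sqrt hS.le hwin
    rwa [Real.sqrt_sq (by positivity)] at h
  have hgap : c * Real.sqrt S < 1 / 8 := by
    have : c * Real.sqrt S < c * (8 * (1 : ℝ) * c)⁻¹ := mul_lt_mul_of_pos_left hsqrt hc
    rw [show c * (8 * (1 : ℝ) * c)⁻¹ = 1 / 8 by field_simp] at this
    exact this
  set κ : ℝ := 2 * (1 / 8 - c * Real.sqrt S) with hκdef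
  have hκ : 0 < κ := by rw [hκdef]; linarith
  refine periodic_nonneg_eq_zero_of_deriv_le hS hκ hper hE hnn fun s => ?_
  have h1 := hbal s
  have h2 : 0 ≤ (1 - c * Real.sqrt S) * D s := mul_nonneg (by linarith) (hD s)
  rw [hκdef]
  nlinarith [hnn s, hD s]

end Summit.NavierStokesRegularity.NavierStokesRegularity.Cruxes.ScarEnvelopeTypeI.DssWindowCert

end
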